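import Summits.Ventures.Crystal3D.Theorems.StickyWulffConstantStackingLiminfCalibratedProfileBound
import Summits.Ventures.Crystal3D.Theorems.StickyWulffConstantStackingLiminfOptimalCalibrationL5
import HarnessLib

/-!
# The OPTIMAL profile bound (generic `c, δ`; `M`-dependent `ω_M`): the exact ceiling
# `(243 + 54√3·c + 45c²/4)^{1/3}` of the word-uniform layer-profile ladder — crux `StackingLiminf`
# (stmt-Ventures-19145), cf-p2 R20

Route `StickyWulffConstant` of the venture `Summits/Ventures/Crystal3D` (cell `crystal3d-full`).
`profile_bound_cal` (`…CalibratedProfileBound.lean`) calibrated with the constant `ω₃₁ ≤ ω_M` and the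
tangent-line value `B = 3 − 2c/β_c`, reaching `∛338 / ∛369`.  This file runs the same assembly
(`interface_calibration_cap`, total variation of `G ∘ n` through the largest layer `M`, the per-layer
identity `ω_M n/√M ≤ d + Ψ₂(n)`) with
* the OPTIMAL value `B_c M − K'_c √M ≤ 2G(M)`, `B_c = 1 + (2/3)(36 + 6√3c + c²)/β_c²`
  (`Bopt_mul_le_two_mul_G_top`, `…OptimalCalibrationL5.lean`), and
* `ω_M ≥ β_c − κ_c/√M` (`κ_c = δ + √3/(2√31)`) kept `M`-dependent, in three regimes:
  `M ≤ 30` (`∑ d ≥ 3N/5`); `31 ≤ M ≤ √N` (`ω_M ≥ 3` ⇒ `ω_M N/√M ≥ 3N^{3/4}`);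
  `M > √N` (`κ_c N/M ≤ κ_c √N`, then AM–GM with `ω = β_c`, `27β_c²B_c/4 = 243 + 54√3c + 45c²/4`
  by `ceiling_identity`).
Result (`profile_bound_opt`): from `layerProfile`-type data,
`C ≤ 6N − min(3N/5, 3N^{3/4} − K'_c√N, (243 + 54√3c + 45c²/4)^{1/3}·N^{2/3} − (κ_c + K'_c)√N)`,
`K'_c = c + 2√3/c + 4β_c/(c√31)` — i.e. the ladder's exact ceiling `∛347.78 = 7.0324` (`c = 1`) /
`∛397.77 = 7.3544` (`c = √2, δ = 1/2`) of cf-p2 R20 (kit j262960/j263200/j262988; blueprint =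
evidence #15, Lean companion = evidence #18 on stmt-Ventures-19145) up to `O(√N)`.
WHAT THIS IS NOT: `StackingLiminf` (∛432 = 7.5595 needs more than the layer-profile ladder:
R20 §6); nothing about which stacking is optimal; rung F-C1 not moved.
-/

noncomputable section

namespace Summit.Ventures.Crystal3D.Theorems.OptimalCalibration

open Finset
open Summit.Ventures.Crystal3D.Theorems

/-- `√M ≤ N^{1/4}` when `M² ≤ N`. -/
theorem sqrt_le_rpow_quarter {M N : ℝ} (h : M ^ 2 ≤ N) :
    Real.sqrt M ≤ N ^ ((1 : ℝ) / 4) := by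
  have hN : 0 ≤ N := le_trans (by positivity) h
  have h1 : M ≤ Real.sqrt N := Real.le_sqrt_of_sq_le h
  have h2 : Real.sqrt M ≤ Real.sqrt (Real.sqrt N) := Real.sqrt_le_sqrt h1
  have h3 : Real.sqrt (Real.sqrt N) = N ^ ((1 : ℝ) / 4) := by
    rw [Real.sqrt_eq_rpow, Real.sqrt_eq_rpow, ← Real.rpow_mul hN]; norm_num
  rw [← h3]; exact h2

/-- `N / N^{1/4} = N^{3/4}` for `N > 0`. -/
theorem div_rpow_quarter {N : ℝ} (hN : 0 < N) : N / N ^ ((1 : ℝ) / 4) = N ^ ((3 : ℝ) / 4) := by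
  rw [div_eq_iff (by positivity), ← Real.rpow_add hN]; norm_num

set_option maxHeartbeats 400000 in
/-- **The optimal profile bound** (generic `c, δ`, `M`-dependent `ω_M`).  From the data of
`layerProfile`-type (any `C` with `C + ∑ d + ∑ b ≤ 6N`, Harborth bound per layer, shallow interface
bound `(1/2)|Δ| + c√max − δ ≤ b`):
`C ≤ 6N − min(3N/5, 3N^{3/4} − K'√N, (243 + 54√3c + 45c²/4)^{1/3} N^{2/3} − (κ + K')√N)` with
`κ = δ + √3/(2√31)`, `K' = c + 2√3/c + 4(2√3 + c)/(c√31)`. -/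
theorem profile_bound_opt {N : ℕ} (hN : 0 < N) {c δ : ℝ} (hc : 0 < c) (hc2 : c ≤ 2)
    (hδ : 0 ≤ δ) (hδc : δ ≤ c) (hδ2 : δ * (2 + c / 2) ≤ c ^ 2)
    {C : ℝ} {kmin kmax : ℤ} {n : ℤ → ℕ} {d b : ℤ → ℝ}
    (hkk : kmin ≤ kmax) (hsupp : ∀ κ, n κ ≠ 0 → kmin ≤ κ ∧ κ ≤ kmax)
    (hsum : ∑ κ ∈ Finset.Icc kmin kmax, n κ = N) (hd0 : ∀ κ, n κ = 0 → d κ = 0)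
    (hd : ∀ κ, 0 ≤ d κ ∧ 12 * (n κ : ℝ) ≤ d κ ^ 2 + 3)
    (hb1 : ∀ κ, 3 / 2 * |(n κ : ℝ) - n (κ + 1)| ≤ b κ)
    (hb2 : ∀ κ, 1 / 2 * |(n κ : ℝ) - n (κ + 1)| + c * Real.sqrt (max (n κ : ℝ) (n (κ + 1))) - δ
      ≤ b κ)
    (hC : C + ∑ κ ∈ Finset.Icc kmin kmax, d κ + ∑ κ ∈ Finset.Icc (kmin - 1) kmax, b κ ≤ 6 * N) :
    C ≤ 6 * N -
      min (3 / 5 * (N : ℝ))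
        (min (3 * (N : ℝ) ^ ((3 : ℝ) / 4) -
            (c + 2 * Real.sqrt 3 / c + 4 * (2 * Real.sqrt 3 + c) / (c * Real.sqrt 31)) *
              Real.sqrt N)
          ((243 + 54 * Real.sqrt 3 * c + 45 * c ^ 2 / 4) ^ ((1 : ℝ) / 3) * (N : ℝ) ^ ((2 : ℝ) / 3) -
            (δ + Real.sqrt 3 / (2 * Real.sqrt 31) +
              (c + 2 * Real.sqrt 3 / c + 4 * (2 * Real.sqrt 3 + c) / (c * Real.sqrt 31))) *
              Real.sqrt N)) := by
  set Λ := Finset.Icc kmin kmax with hΛ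
  set I := Finset.Icc (kmin - 1) kmax with hI
  set κ₁ : ℝ := δ + Real.sqrt 3 / (2 * Real.sqrt 31) with hκ₁
  set K' : ℝ := c + 2 * Real.sqrt 3 / c + 4 * (2 * Real.sqrt 3 + c) / (c * Real.sqrt 31) with hK'
  set cs : ℝ := (243 + 54 * Real.sqrt 3 * c + 45 * c ^ 2 / 4) ^ ((1 : ℝ) / 3) with hcs
  have hs3 : 0 < Real.sqrt 3 := Real.sqrt_pos.2 (by norm_num)
  have hs31 : 0 < Real.sqrt 31 := Real.sqrt_pos.2 (by norm_num)
  have hβpos : 0 < 2 * Real.sqrt 3 + c := by positivity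
  have hK'pos : 0 ≤ K' := by rw [hK']; positivity
  have hκ₁0 : 0 ≤ κ₁ := by rw [hκ₁]; positivity
  have hcs0 : 0 ≤ cs := by rw [hcs]; positivity
  have hΛne : Λ.Nonempty := ⟨kmin, mem_Icc.2 ⟨le_rfl, hkk⟩⟩
  -- the largest layer
  obtain ⟨κ₀, hκ₀Λ, hκ₀⟩ := exists_max_image Λ n hΛne
  obtain ⟨M, hMdef⟩ : ∃ M : ℕ, n κ₀ = M := ⟨_, rfl⟩
  have hnM : ∀ κ, n κ ≤ M := by
    intro κ
    by_cases hκ : κ ∈ Λ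
    · exact hMdef ▸ hκ₀ κ hκ
    · have : n κ = 0 := by
        by_contra h
        exact hκ (mem_Icc.2 (hsupp κ h))
      simp [this]
  have hMN : M ≤ N := by
    rw [← hMdef, ← hsum]
    exact single_le_sum (fun κ _ => Nat.zero_le (n κ)) hκ₀Λ
  have hM1 : 1 ≤ M := by
    by_contra hM0
    have hz : ∀ κ ∈ Λ, n κ = 0 := fun κ _ => by have := hnM κ; omega
    have : ∑ κ ∈ Λ, n κ = 0 := sum_eq_zero hz
    omega
  have hM1r : (1 : ℝ) ≤ M := by exact_mod_cast hM1
  have hMNr : (M : ℝ) ≤ N := by exact_mod_cast hMN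
  have hNr : (1 : ℝ) ≤ N := hM1r.trans hMNr
  have hNpos : (0 : ℝ) < N := by linarith
  have hsqN1 : 1 ≤ Real.sqrt N := by
    rw [show (1 : ℝ) = Real.sqrt 1 from Real.sqrt_one.symm]; exact Real.sqrt_le_sqrt hNr
  have hsN0 : 0 ≤ Real.sqrt (N : ℝ) := Real.sqrt_nonneg _
  -- the interface terms are nonnegative
  have hb0 : ∀ κ, 0 ≤ b κ := fun κ => le_trans (by positivity) (hb1 κ)
  have hsumb0 : 0 ≤ ∑ κ ∈ I, b κ := sum_nonneg fun κ _ => hb0 κ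
  -- in-layer, through concavity: `∑ d ≥ (N/M)·√(12M − 3)`
  have hsum_r : ∑ κ ∈ Λ, (n κ : ℝ) = N := by exact_mod_cast hsum
  have hdsum : (N : ℝ) * Real.sqrt (12 * M - 3) / M ≤ ∑ κ ∈ Λ, d κ := by
    have hper : ∀ κ ∈ Λ, (n κ : ℝ) * Real.sqrt (12 * M - 3) / M ≤ d κ := by
      intro κ _
      by_cases hκ : n κ = 0
      · rw [hκ, hd0 κ hκ]; simp
      · exact sqrt_layer_ge (by exact_mod_cast Nat.pos_of_ne_zero hκ)
          (by exact_mod_cast hnM κ) (hd κ).1 (hd κ).2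
    calc (N : ℝ) * Real.sqrt (12 * M - 3) / M
        = ∑ κ ∈ Λ, (n κ : ℝ) * Real.sqrt (12 * M - 3) / M := by
          rw [← sum_div, ← sum_mul, hsum_r]
      _ ≤ ∑ κ ∈ Λ, d κ := sum_le_sum hper
  -- the three-way minimum
  set m₂ : ℝ := 3 * (N : ℝ) ^ ((3 : ℝ) / 4) - K' * Real.sqrt N with hm₂
  set m₃ : ℝ := cs * (N : ℝ) ^ ((2 : ℝ) / 3) - (κ₁ + K') * Real.sqrt N with hm₃
  have hmin1 : min (3 / 5 * (N : ℝ)) (min m₂ m₃) ≤ 3 / 5 * (N : ℝ) := min_le_left _ _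
  have hmin2 : min (3 / 5 * (N : ℝ)) (min m₂ m₃) ≤ m₂ :=
    (min_le_right _ _).trans (min_le_left _ _)
  have hmin3 : min (3 / 5 * (N : ℝ)) (min m₂ m₃) ≤ m₃ :=
    (min_le_right _ _).trans (min_le_right _ _)
  rcases le_or_gt (M : ℝ) 30 with hM30 | hM31
  · -- few balls per layer: `∑ d ≥ 3N/5`
    have ht : 3 / 5 * (M : ℝ) ≤ Real.sqrt (12 * M - 3) := by
      have h := Real.sqrt_le_sqrt (show (3 / 5 * (M : ℝ)) ^ 2 ≤ 12 * M - 3 by nlinarith)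
      rwa [Real.sqrt_sq (by positivity)] at h
    have h35 : 3 / 5 * (N : ℝ) ≤ ∑ κ ∈ Λ, d κ := by
      refine le_trans ?_ hdsum
      rw [le_div_iff₀ (by linarith)]
      nlinarith
    linarith
  · -- large layers: calibration
    have hM31n : 31 ≤ M := by
      have : (30 : ℝ) < (M : ℕ) := hM31
      have : 30 < M := by exact_mod_cast this
      omega
    have hM31' : (31 : ℝ) ≤ M := by exact_mod_cast hM31n
    have hMpos : (0 : ℝ) < M := by linarith
    have hsMpos : 0 < Real.sqrt M := Real.sqrt_pos.2 hMpos
    have hMM : Real.sqrt M * Real.sqrt M = M := Real.mul_self_sqrt hMpos.le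
    -- calibration at every interface
    have hcal : ∀ κ, Psi2 c δ M (n κ) / 2 + Psi2 c δ M (n (κ + 1)) / 2 +
        |G c δ M (n κ) - G c δ M (n (κ + 1))| ≤ b κ := by
      intro κ
      exact interface_calibration_cap (c := c) (δ := δ) (β := b κ) (M := M) (p := n κ)
        (q := n (κ + 1)) (θ := thetaW c δ M) (Ψ := Psi c δ M) (Ψ₂ := Psi2 c δ M) hc hδ hδ2
        (hnM κ) (hnM (κ + 1)) (fun x => thetaW_nonneg hc δ M x)
        (fun x hx hxM => thetaW_cap hc hc2 hδ hδc hM31n hx hxM)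
        (fun x y hxy hyM => thetaW_mul_le_Psi_sub hc hc2 hδ hδc hM31n hxy hyM)
        (fun x => Psi2_le hc δ M x)
        (fun x y hxy hyM => G_mono hc hc2 hδ hδc hM31n hxy hyM) (hb1 κ) (hb2 κ)
    have hsum_cal : ∑ κ ∈ I, (Psi2 c δ M (n κ) / 2 + Psi2 c δ M (n (κ + 1)) / 2 +
        |G c δ M (n κ) - G c δ M (n (κ + 1))|) ≤ ∑ κ ∈ I, b κ := sum_le_sum fun κ _ => hcal κ
    -- the `Ψ₂`-halves collect EXACTLY to `∑_Λ Ψ₂(n)` (empty layers outside `Λ`, `Ψ₂(0) = 0`)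
    have hn_lo : n (kmin - 1) = 0 := by
      by_contra h; have := (hsupp _ h).1; omega
    have hn_hi : n (kmax + 1) = 0 := by
      by_contra h; have := (hsupp _ h).2; omega
    have hi : ∑ κ ∈ I, Psi2 c δ M (n κ) = ∑ κ ∈ Λ, Psi2 c δ M (n κ) := by
      rw [hI, hΛ]
      have hsplit : Finset.Icc (kmin - 1) kmax = insert (kmin - 1) (Finset.Icc kmin kmax) := by
        ext κ; simp only [mem_insert, mem_Icc]; omega
      rw [hsplit, sum_insert (by simp)]
      rw [hn_lo, Psi2_zero, zero_add]
    have hii : ∑ κ ∈ I, Psi2 c δ M (n (κ + 1)) = ∑ κ ∈ Λ, Psi2 c δ M (n κ) := by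
      have e : ∑ κ ∈ I, Psi2 c δ M (n (κ + 1)) =
          ∑ κ ∈ Finset.Icc (kmin - 1 + 1) (kmax + 1), Psi2 c δ M (n κ) := by
        rw [← Finset.map_add_right_Icc, Finset.sum_map]; rfl
      rw [e, sub_add_cancel, hΛ]
      have hsplit : Finset.Icc kmin (kmax + 1) = insert (kmax + 1) (Finset.Icc kmin kmax) := by
        ext κ; simp only [mem_insert, mem_Icc]; omega
      rw [hsplit, sum_insert (by simp)]
      rw [hn_hi, Psi2_zero, zero_add]
    -- the total variation of `G ∘ n` through the largest layer
    have htv : 2 * G c δ M M ≤ ∑ κ ∈ I, |G c δ M (n κ) - G c δ M (n (κ + 1))| := by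
      set L' : ℕ := (kmax - kmin + 2).toNat with hL'
      set g : ℕ → ℝ := fun j => G c δ M (n (kmin - 1 + j)) with hg
      have hre : ∑ κ ∈ I, |G c δ M (n κ) - G c δ M (n (κ + 1))| =
          ∑ j ∈ Finset.range L', |g (j + 1) - g j| := by
        refine Finset.sum_nbij' (fun κ => (κ - (kmin - 1)).toNat) (fun j => kmin - 1 + (j : ℤ))
          ?_ ?_ ?_ ?_ ?_
        · intro κ hκ; have := mem_Icc.1 hκ; rw [Finset.mem_range]; omega
        · intro j hj; rw [Finset.mem_range] at hj; rw [mem_Icc]; omega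
        · intro κ hκ; have := mem_Icc.1 hκ; omega
        · intro j hj; omega
        · intro κ hκ
          have hκ' := mem_Icc.1 hκ
          have e1 : kmin - 1 + (((κ - (kmin - 1)).toNat : ℕ) : ℤ) = κ := by omega
          have e2 : kmin - 1 + (((κ - (kmin - 1)).toNat + 1 : ℕ) : ℤ) = κ + 1 := by
            push_cast; omega
          simp only [hg, e1, e2]
          exact abs_sub_comm _ _
      rw [hre]
      have hj₀ : (κ₀ - (kmin - 1)).toNat ≤ L' := by have := mem_Icc.1 hκ₀Λ; omega
      have hg0 : g 0 = 0 := by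
        simp only [hg, Nat.cast_zero, add_zero, hn_lo]; exact G_zero c δ M
      have hgL : g L' = 0 := by
        have hnL : n (kmin - 1 + L') = 0 := by
          by_contra h; have := (hsupp _ h).2; omega
        simp only [hg, hnL]; exact G_zero c δ M
      have hgj : g ((κ₀ - (kmin - 1)).toNat) = G c δ M M := by
        have e1 : kmin - 1 + (((κ₀ - (kmin - 1)).toNat : ℕ) : ℤ) = κ₀ := by
          have := mem_Icc.1 hκ₀Λ; omega
        simp only [hg, e1, hMdef]
      have htv' := two_mul_le_sum_abs_sub g hj₀ hg0 hgL
      rwa [hgj] at htv'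
    -- per layer: `d + Ψ₂(n) ≥ ω n / √M`
    have hW : omega c δ M * (N : ℝ) / Real.sqrt M ≤ ∑ κ ∈ Λ, (d κ + Psi2 c δ M (n κ)) := by
      have hper : ∀ κ ∈ Λ, omega c δ M * (n κ : ℝ) / Real.sqrt M ≤ d κ + Psi2 c δ M (n κ) := by
        intro κ _
        by_cases hκ : n κ = 0
        · rw [hd0 κ hκ, hκ, Psi2_zero]; simp
        · exact layer_identity c δ M (Nat.pos_of_ne_zero hκ) (hd κ).1 (hd κ).2
      calc omega c δ M * (N : ℝ) / Real.sqrt M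
          = ∑ κ ∈ Λ, omega c δ M * (n κ : ℝ) / Real.sqrt M := by
            rw [← sum_div, ← mul_sum, hsum_r]
        _ ≤ _ := sum_le_sum hper
    -- the optimal value of the dual
    have hval := Bopt_mul_le_two_mul_G_top hc hδ hM31n
    rw [← hK'] at hval
    -- bookkeeping: `∑_Λ d + ∑_I b ≥ ω_M N/√M + 2G(M)`
    have h1 : ∑ κ ∈ Λ, (d κ + Psi2 c δ M (n κ)) = ∑ κ ∈ Λ, d κ + ∑ κ ∈ Λ, Psi2 c δ M (n κ) :=
      sum_add_distrib
    have h2 : ∑ κ ∈ I, (Psi2 c δ M (n κ) / 2 + Psi2 c δ M (n (κ + 1)) / 2 +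
        |G c δ M (n κ) - G c δ M (n (κ + 1))|) =
        (∑ κ ∈ I, Psi2 c δ M (n κ)) / 2 + (∑ κ ∈ I, Psi2 c δ M (n (κ + 1))) / 2 +
          ∑ κ ∈ I, |G c δ M (n κ) - G c δ M (n (κ + 1))| := by
      rw [sum_add_distrib, sum_add_distrib, sum_div, sum_div]
    have hS : omega c δ M * (N : ℝ) / Real.sqrt M + 2 * G c δ M M ≤
        ∑ κ ∈ Λ, d κ + ∑ κ ∈ I, b κ := by
      linarith [hsum_cal, hi, hii, htv, hW, h1, h2]
    have hsqrtMN : Real.sqrt M ≤ Real.sqrt N := Real.sqrt_le_sqrt hMNr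
    have hKM : K' * Real.sqrt M ≤ K' * Real.sqrt N := mul_le_mul_of_nonneg_left hsqrtMN hK'pos
    have hBopt0 : 0 ≤ (1 + 2 / 3 * (36 + 6 * Real.sqrt 3 * c + c ^ 2) / (2 * Real.sqrt 3 + c) ^ 2) := by
      positivity
    have hBM0 : 0 ≤ (1 + 2 / 3 * (36 + 6 * Real.sqrt 3 * c + c ^ 2) / (2 * Real.sqrt 3 + c) ^ 2) *
        (M : ℝ) := by positivity
    rcases le_or_gt (M * M) N with hMMN | hNMM
    · -- medium layers `31 ≤ M ≤ √N`: `ω_M ≥ 3` and `N/√M ≥ N^{3/4}`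
      have hω3 : 3 ≤ omega c δ M := three_le_omega hδ hδc hM31n
      have hMMr : (M : ℝ) ^ 2 ≤ N := by exact_mod_cast (sq (M : ℕ)) ▸ hMMN
      have hq : Real.sqrt M ≤ (N : ℝ) ^ ((1 : ℝ) / 4) := sqrt_le_rpow_quarter hMMr
      have hq0 : 0 < (N : ℝ) ^ ((1 : ℝ) / 4) := by positivity
      have h34 : 3 * (N : ℝ) ^ ((3 : ℝ) / 4) ≤ 3 * (N : ℝ) / Real.sqrt M := by
        rw [← div_rpow_quarter hNpos, mul_div_assoc]
        exact mul_le_mul_of_nonneg_left (div_le_div_of_nonneg_left hNpos.le hsMpos hq)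
          (by norm_num)
      have hω3N : 3 * (N : ℝ) / Real.sqrt M ≤ omega c δ M * (N : ℝ) / Real.sqrt M :=
        div_le_div_of_nonneg_right (mul_le_mul_of_nonneg_right hω3 hNpos.le) hsMpos.le
      have hm₂le : m₂ ≤ ∑ κ ∈ Λ, d κ + ∑ κ ∈ I, b κ := by
        rw [hm₂]; linarith [hS, hval, h34, hω3N, hKM, hBM0]
      linarith [hmin2, hm₂le]
    · -- thick layers `M > √N`: `κ N/M ≤ κ √N`, then AM–GM with `ω = β_c`
      have hNMMr : (N : ℝ) < (M : ℝ) * M := by exact_mod_cast hNMM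
      have hsqNM : Real.sqrt N ≤ M := by
        have h := Real.sqrt_le_sqrt hNMMr.le
        rwa [Real.sqrt_mul_self hMpos.le] at h
      have hNN : Real.sqrt N * Real.sqrt N = N := Real.mul_self_sqrt hNpos.le
      have hNM : (N : ℝ) / M ≤ Real.sqrt N := by
        rw [div_le_iff₀ hMpos]
        have := mul_le_mul_of_nonneg_left hsqNM hsN0
        linarith [hNN]
      have hωge := omega_ge (c := c) hδ hM31n
      rw [← hκ₁] at hωge
      -- `(β − κ/√M) N/√M = β N/√M − κ N/M`
      have hωN : (2 * Real.sqrt 3 + c) * (N : ℝ) / Real.sqrt M - κ₁ * ((N : ℝ) / M) ≤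
          omega c δ M * (N : ℝ) / Real.sqrt M := by
        have h := div_le_div_of_nonneg_right
          (mul_le_mul_of_nonneg_right hωge hNpos.le) hsMpos.le
        have e1 : κ₁ / Real.sqrt M * (N : ℝ) / Real.sqrt M =
            κ₁ * ((N : ℝ) / (Real.sqrt M * Real.sqrt M)) := by ring
        rw [hMM] at e1
        have e2 : (2 * Real.sqrt 3 + c - κ₁ / Real.sqrt M) * (N : ℝ) / Real.sqrt M =
            (2 * Real.sqrt 3 + c) * (N : ℝ) / Real.sqrt M - κ₁ / Real.sqrt M * (N : ℝ) / Real.sqrt M := by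
          ring
        linarith [h, e1, e2]
      have hκN : κ₁ * ((N : ℝ) / M) ≤ κ₁ * Real.sqrt N := mul_le_mul_of_nonneg_left hNM hκ₁0
      -- AM–GM with the optimal `B_c` and `ceiling_identity`
      have hAM := rpow_le_div_sqrt_add_mul (N := (N : ℝ)) (M := (M : ℝ)) (ω := 2 * Real.sqrt 3 + c)
        (β := 1 + 2 / 3 * (36 + 6 * Real.sqrt 3 * c + c ^ 2) / (2 * Real.sqrt 3 + c) ^ 2)
        hNpos.le hMpos hβpos.le hBopt0
      rw [ceiling_identity hc.le, ← hcs] at hAM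
      have hm₃le : m₃ ≤ ∑ κ ∈ Λ, d κ + ∑ κ ∈ I, b κ := by
        rw [hm₃]; linarith [hS, hval, hωN, hκN, hAM, hKM]
      linarith [hmin3, hm₃le]

end Summit.Ventures.Crystal3D.Theorems.OptimalCalibration

end
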